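import Summits.CriticalPhenomena.CardyFormulaZ2.Theorems.CardyComplexConeParafermionToSLESixFamiliesPercDomainMarkov
import Literature.Probability.LatticeModels.FKInterfaceDrivingLocality
import HarnessLib

/-!
# The discrete past stopped at a prefix-decided step (input (T2) of `PercFaceAnnulusTransfer`, lattice side)

Crux `Summit.CriticalPhenomena.CardyFormulaZ2.Theses.CardyUniqueLimit.CardyRigidity`
(stmt-CriticalPhenomena-0746), line `crossing_martingale`, stub A2‴ `stub_percFaceAnnulusTransfer :
Driver.PercFaceAnnulusTransfer` (`…FaceHalfPlaneG2OfTransfer.lean`), input (T2): "a countable-valued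
discrete past `pref` with measurable fibres determined by revealed edge sets `Rev d`" — Kemppainen–
Smirnov's "the law of percolation conditioned to the vertices explored up to time `n`" (§4.2) for a
RANDOM step `n = N(ω)` decided by the explored prefix itself (the first step at which the prefix trace
meets `φ_k(F)` or exceeds capacity `u`).  For the tree's exploration (`explorationPrefix`,
`explorationCylinder`, `revealedFreeEdges`) and any predicate `P n l` of the step and the prefix
`l = explorationPrefix D n ω` that is eventually true along every exploration:

* `Past.stopStep hD P ω` — the first `n` with `P n (explorationPrefix D n ω)`; it is a CLASS step: on the
  prefix event `C_n(ω₀)`, `n = stopStep ω₀`, it equals `n` (`stopStep_eq_of_mem`);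
* `Past.past hD P ω = (N, explorationPrefix D N ω)`, `N = stopStep ω` — the discrete past, with values in
  the countable type `ℕ × List MedialVertex`; its fibre through `ω₀` is the prefix event
  `C_{N(ω₀)}(ω₀)` (`past_eq_iff`, `preimage_past_eq`), hence measurable;
* `Past.revealed hD P d` — the revealed free edges of the value `d`; on the fibre through `ω₀` they are
  `revealedFreeEdges hD ω₀ N(ω₀)` (`revealed_past`), every fibre `{past = d}` is determined by
  `revealed d` (`determinedBy_preimage_past`), and every edge of `revealed (past ω)` is an explored
  edge `cTgt` of a corner of index `< N(ω)` (`exists_lt_of_mem_revealed_past`).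

References: A. Kemppainen, S. Smirnov, Ann. Probab. 45 (2017), §4.2 (Prop. 4.7, Remark 4.8)
[KemppainenSmirnov2017]; H. Duminil-Copin, S. Smirnov, Clay Math. Proc. 15 (2012), §6.2, Lemma 6.6
[DuminilCopinSmirnov2012Clay].
-/

noncomputable section

open MeasureTheory Set
open Literature.Probability Literature.Probability.LatticeModels Literature.Probability.Percolation
open Literature.Probability.LatticeModels.DiscreteDobrushin
open Summit.CriticalPhenomena.CardyFormulaZ2.Cruxes.ParafermionToSLESixFamilies.CaratheodoryNetSlitUniformity
  (revealedFreeEdges revealedFreeEdges_eq_of_mem determinedBy_explorationCylinder)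

namespace Summit.CriticalPhenomena.CardyFormulaZ2.Cruxes.CardyRigidity.CrossingMartingale

namespace Past

variable {D : DiscreteDobrushin} (hD : D.IsZdAdmissible)
  (P : ℕ → List MedialVertex → Prop) (hP : ∀ ω : BondConfig (Site 2), ∃ n, P n (explorationPrefix D n ω))

/-! ### The class stopping step -/

open Classical in
/-- **The stopping step**: the first `n` at which the explored prefix satisfies `P n`.
[cite: KemppainenSmirnov2017, §4.2] -/
def stopStep (ω : BondConfig (Site 2)) : ℕ := Nat.find (hP ω)

/-- The prefix at the stopping step satisfies `P`. [cite: KemppainenSmirnov2017, §4.2] -/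
theorem stopStep_spec (ω : BondConfig (Site 2)) :
    P (stopStep P hP ω) (explorationPrefix D (stopStep P hP ω) ω) := by
  classical
  exact Nat.find_spec (hP ω)

/-- Before the stopping step the prefix does not satisfy `P`. [cite: KemppainenSmirnov2017, §4.2] -/
theorem not_of_lt_stopStep (ω : BondConfig (Site 2)) {m : ℕ} (hm : m < stopStep P hP ω) :
    ¬ P m (explorationPrefix D m ω) := by
  classical
  exact Nat.find_min (hP ω) hm

/-- The stopping step is at most any step whose prefix satisfies `P`. [cite: KemppainenSmirnov2017, §4.2] -/
theorem stopStep_le (ω : BondConfig (Site 2)) {m : ℕ} (hm : P m (explorationPrefix D m ω)) :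
    stopStep P hP ω ≤ m := by
  classical
  exact Nat.find_min' (hP ω) hm

variable {P hP}

/-- **The stopping step is a class step**: on the prefix event `C_n(ω₀)` with `n = stopStep ω₀` it is
constantly `n` (the prefixes up to step `n` agree there). [cite: DuminilCopinSmirnov2012Clay, §6.2, Lemma 6.6] -/
theorem stopStep_eq_of_mem {ω₀ ω : BondConfig (Site 2)}
    (hω : ω ∈ explorationCylinder hD ω₀ (stopStep P hP ω₀)) : stopStep P hP ω = stopStep P hP ω₀ := by
  set n := stopStep P hP ω₀ with hn
  have hpre : ∀ m ≤ n, explorationPrefix D m ω = explorationPrefix D m ω₀ := fun m hm ↦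
    explorationPrefix_eq_of_mem_explorationCylinder (explorationCylinder_antitone ω₀ hm hω)
  apply le_antisymm
  · refine stopStep_le P hP ω ?_
    rw [hpre n le_rfl]
    exact stopStep_spec P hP ω₀
  · by_contra hlt
    push Not at hlt
    have h1 := stopStep_spec P hP ω
    rw [hpre _ hlt.le] at h1
    exact not_of_lt_stopStep P hP ω₀ hlt h1

/-! ### The discrete past and its fibres -/

variable (P hP) in
/-- **The discrete past**: the stopping step together with the explored prefix up to it (a value of
the countable type `ℕ × List MedialVertex`). [cite: KemppainenSmirnov2017, §4.2] -/
def past (ω : BondConfig (Site 2)) : ℕ × List MedialVertex :=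
  (stopStep P hP ω, explorationPrefix D (stopStep P hP ω) ω)

/-- **The fibres of the discrete past are prefix events**: `past ω = past ω₀` iff `ω` lies in the
prefix event of `ω₀` at its stopping step. [cite: DuminilCopinSmirnov2012Clay, §6.2, Lemma 6.6] -/
theorem past_eq_iff {ω₀ ω : BondConfig (Site 2)} :
    past P hP ω = past P hP ω₀ ↔ ω ∈ explorationCylinder hD ω₀ (stopStep P hP ω₀) := by
  constructor
  · intro h
    have h1 : stopStep P hP ω = stopStep P hP ω₀ := congrArg Prod.fst h
    have h2 : explorationPrefix D (stopStep P hP ω) ω = explorationPrefix D (stopStep P hP ω₀) ω₀ :=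
      congrArg Prod.snd h
    rw [h1] at h2
    rw [explorationCylinder_eq_preimage_explorationPrefix]
    exact h2
  · intro hω
    have h1 := stopStep_eq_of_mem hD hω
    have h2 : explorationPrefix D (stopStep P hP ω₀) ω = explorationPrefix D (stopStep P hP ω₀) ω₀ :=
      explorationPrefix_eq_of_mem_explorationCylinder hω
    simp only [past, h1, h2]

/-- The fibre of the discrete past through `ω₀` is the prefix event `C_{N(ω₀)}(ω₀)`.
[cite: DuminilCopinSmirnov2012Clay, §6.2, Lemma 6.6] -/
theorem preimage_past_eq (ω₀ : BondConfig (Site 2)) :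
    past P hP ⁻¹' {past P hP ω₀} = explorationCylinder hD ω₀ (stopStep P hP ω₀) :=
  Set.ext fun _ ↦ past_eq_iff hD

include hD in
/-- **The fibres of the discrete past are measurable.** [cite: DuminilCopinSmirnov2012Clay, §6.2, Lemma 6.6] -/
theorem measurableSet_preimage_past (d : ℕ × List MedialVertex) :
    MeasurableSet (past P hP ⁻¹' {d} : Set (BondConfig (Site 2))) := by
  by_cases h : ∃ ω₀, past P hP ω₀ = d
  · obtain ⟨ω₀, rfl⟩ := h
    rw [preimage_past_eq hD]
    exact measurableSet_explorationCylinder ω₀ _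
  · have : past P hP ⁻¹' {d} = (∅ : Set (BondConfig (Site 2))) :=
      Set.eq_empty_of_forall_notMem fun ω hω ↦ h ⟨ω, hω⟩
    rw [this]
    exact MeasurableSet.empty

/-! ### The revealed edges of a value of the past -/

variable (P hP) in
/-- **The revealed edges of the value `d` of the discrete past**: the revealed free edges, up to the
step `d.1`, of the configurations with past `d` (all equal, `revealed_past`).
[cite: KemppainenSmirnov2017, §4.2] -/
def revealed (d : ℕ × List MedialVertex) : Set (Sym2 (Site 2)) :=
  {e | ∃ ω₀ : BondConfig (Site 2), past P hP ω₀ = d ∧ e ∈ revealedFreeEdges hD ω₀ d.1}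

/-- On the fibre through `ω`, the revealed edges are the revealed free edges of `ω` up to its stopping
step. [cite: DuminilCopinSmirnov2012Clay, §6.2, Lemma 6.6] -/
theorem revealed_past (ω : BondConfig (Site 2)) :
    revealed hD P hP (past P hP ω) = revealedFreeEdges hD ω (stopStep P hP ω) := by
  ext e
  constructor
  · rintro ⟨ω₀, h0, he⟩
    have hmem : ω₀ ∈ explorationCylinder hD ω (stopStep P hP ω) := (past_eq_iff hD).1 h0
    rwa [← revealedFreeEdges_eq_of_mem hmem]
  · intro he
    exact ⟨ω, rfl, he⟩

/-- **Every fibre of the discrete past is determined by its revealed edges.**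
[cite: KemppainenSmirnov2017, §4.2] -/
theorem determinedBy_preimage_past (d : ℕ × List MedialVertex) :
    DeterminedBy (past P hP ⁻¹' {d}) (revealed hD P hP d) := by
  by_cases h : ∃ ω₀, past P hP ω₀ = d
  · obtain ⟨ω₀, rfl⟩ := h
    rw [preimage_past_eq hD, revealed_past hD]
    exact determinedBy_explorationCylinder ω₀ _
  · have : past P hP ⁻¹' {d} = (∅ : Set (BondConfig (Site 2))) :=
      Set.eq_empty_of_forall_notMem fun ω hω ↦ h ⟨ω, hω⟩
    rw [this, determinedBy_iff]
    intro ω ω' _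
    simp

/-- **Revealed edges are early explored edges**: every edge of `revealed (past ω)` is the target edge
`cTgt` of a corner of the exploration orbit of `ω` of index `< stopStep ω` (and `< exitTime ω`), and
a free edge of the domain. [cite: DuminilCopinSmirnov2012Clay, §6.2, proof of Lemma 6.6] -/
theorem exists_lt_of_mem_revealed_past {ω : BondConfig (Site 2)} {e : Sym2 (Site 2)}
    (he : e ∈ revealed hD P hP (past P hP ω)) :
    ∃ i, i < stopStep P hP ω ∧ i < exitTime hD ω ∧
      e = cTgt (cornerOrbit (D.bcBondConfig ω) (startCorner hD) i) ∧ D.IsFreeEdge e := by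
  rw [revealed_past hD] at he
  obtain ⟨i, hi, rfl, hf⟩ := he
  exact ⟨i, (lt_min_iff.1 hi).1, (lt_min_iff.1 hi).2, rfl, hf⟩

end Past

/-- **Registered form** (anchor `past_determinedBy_preimage_past` of stmt-CriticalPhenomena-0746, input (T2) of
`Driver.PercFaceAnnulusTransfer`): every fibre of the discrete past stopped at a prefix-decided step is determined by its
revealed edges. [cite: KemppainenSmirnov2017, §4.2] -/
theorem past_determinedBy_preimage_past : ∀ {D : Literature.Probability.LatticeModels.DiscreteDobrushin} (hD : D.IsZdAdmissible) {P : ℕ → List Literature.Probability.LatticeModels.MedialVertex → Prop} {hP : ∀ ω : Literature.Probability.Percolation.BondConfig (Literature.Probability.LatticeModels.Site 2), ∃ n, P n (Literature.Probability.LatticeModels.DiscreteDobrushin.explorationPrefix D n ω)} (d : ℕ × List Literature.Probability.LatticeModels.MedialVertex), Literature.Probability.Percolation.DeterminedBy (Past.past P hP ⁻¹' {d}) (Past.revealed hD P hP d) :=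
  fun hD _ _ d ↦ Past.determinedBy_preimage_past hD d

end Summit.CriticalPhenomena.CardyFormulaZ2.Cruxes.CardyRigidity.CrossingMartingale

end
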